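import Summits.CriticalPhenomena.PercolationContinuityZ3.Theorems.PercNearOneGluingAdditiveGluingKnThm2Designated
import Summits.CriticalPhenomena.PercolationContinuityZ3.Theorems.PercNearOneGluingAdditiveGluingBlockGrowth
import HarnessLib

/-! # Crux `PercNearOneGluing.AdditiveGluing` (stmt-CriticalPhenomena-4576) — Kozma–Nitzan's Lemmas 1–2 for ANY NUMBER OF RELAYS
# (seat (d) gen 1): the conditional-probability monotonicity (Lemma 1 (i)/(ii), cleared of denominators) and the superadditivity
# `Σ_{i∈T} φ_{i} ≤ φ_T` of `φ_T := μ(T ↔ o | T ↮ R∖T)` (Lemma 2, singleton decomposition)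

Support file (`--supports stmt-CriticalPhenomena-4576`); no definitions, no named facts.

KN state Lemmas 1–2 for an arbitrary number of points; the tree's `stub_knLemma2` is the three-point instance.  Here: the pair-connection
indicator on the cluster of a vertex set (`knK_monotone_pairConn`, `knK_pairConn_apply`), Lemma 1 (i) for one source against the other
relays with the extra decreasing event "no two of the others are joined" (`knK_lemma1_i`, from BHK Thm 1.4 for set sources,
`stub_bhkSets.2`), Lemma 1 (ii) for the source set `T` (`knK_lemma1_ii`, from BHK Thm 1.3, `stub_bhkSets.1`), the event
`M_T = {every relay of T separated from every other relay}` seen from one source / from the set (`knK_M_eq_single/set`), and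
**Lemma 2** `knK_lemma2`: if `μ(M_T) > 0` then `Σ_{i∈T} μ(D_i ∩ {i↔o})/μ(D_i) ≤ μ(D_T ∩ {T↔o})/μ(D_T)` (`D_i = {i ↮ R∖i}`,
`D_T = {T ↮ R∖T}`): under `M_T` the events `{i ↔ o}` are disjoint.  Used by `knThmK_designated` (the `k`-relay Theorem 2).
[cite: KozmaNitzan2024, Lemmas 1–2 (§2.2, pp. 5–6); VandenbergHaggstromKahn2006, Thms. 1.3–1.4]
-/

namespace Summit.CriticalPhenomena.PercolationContinuityZ3.Theorems

open MeasureTheory Set Literature.Probability.LatticeModels Literature.Probability.Percolation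
open scoped BigOperators

noncomputable section
open Classical

section KnThmKGeneral

variable {V : Type*}

/-- The indicator of the up-set `{C | some k ∈ S₁ and j ∈ S₂, k ≠ j, are joined in C}` is increasing. [folklore] -/
theorem knK_monotone_pairConn (S₁ S₂ : Finset V) :
    Monotone ({C : Set (Sym2 V) | ∃ k ∈ S₁, ∃ j ∈ S₂, k ≠ j ∧ (openGraph C).Reachable k j}.indicator
      (1 : Set (Sym2 V) → ℝ)) := by
  intro C C' hCC'
  by_cases h : C ∈ {C : Set (Sym2 V) | ∃ k ∈ S₁, ∃ j ∈ S₂, k ≠ j ∧ (openGraph C).Reachable k j}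
  · have h' : C' ∈ {C : Set (Sym2 V) | ∃ k ∈ S₁, ∃ j ∈ S₂, k ≠ j ∧ (openGraph C).Reachable k j} := by
      obtain ⟨k, hk, j, hj, hkj, hr⟩ := h
      exact ⟨k, hk, j, hj, hkj, hr.mono (openGraph_mono hCC')⟩
    rw [Set.indicator_of_mem h, Set.indicator_of_mem h', Pi.one_apply, Pi.one_apply]
  · rw [Set.indicator_of_notMem h]
    exact Set.indicator_nonneg (fun _ _ => zero_le_one) _

/-- At `C = C_{S'}(ω)` with `S₁ ⊆ S'`, the pair-connection indicator is `1{∃ k ∈ S₁, j ∈ S₂, k ≠ j, k ↔ j}(ω)`. [folklore] -/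
theorem knK_pairConn_apply (S' S₁ S₂ : Finset V) (h₁ : S₁ ⊆ S') (ω : BondConfig V) :
    {C : Set (Sym2 V) | ∃ k ∈ S₁, ∃ j ∈ S₂, k ≠ j ∧ (openGraph C).Reachable k j}.indicator (1 : Set (Sym2 V) → ℝ)
        (⋃ s' ∈ S', openEdgeCluster ω s') =
      {ω : BondConfig V | ∃ k ∈ S₁, ∃ j ∈ S₂, k ≠ j ∧ (openGraph ω).Reachable k j}.indicator 1 ω := by
  by_cases h : ∃ k ∈ S₁, ∃ j ∈ S₂, k ≠ j ∧ (openGraph ω).Reachable k j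
  · have h1 : (⋃ s' ∈ S', openEdgeCluster ω s') ∈
        {C : Set (Sym2 V) | ∃ k ∈ S₁, ∃ j ∈ S₂, k ≠ j ∧ (openGraph C).Reachable k j} := by
      obtain ⟨k, hk, j, hj, hkj, hr⟩ := h
      exact ⟨k, hk, j, hj, hkj, (knThm2_reachable_biUnion_iff S' (h₁ hk) j ω).2 hr⟩
    have h2 : ω ∈ {ω : BondConfig V | ∃ k ∈ S₁, ∃ j ∈ S₂, k ≠ j ∧ (openGraph ω).Reachable k j} := h
    rw [Set.indicator_of_mem h1, Set.indicator_of_mem h2, Pi.one_apply, Pi.one_apply]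
  · have h1 : (⋃ s' ∈ S', openEdgeCluster ω s') ∉
        {C : Set (Sym2 V) | ∃ k ∈ S₁, ∃ j ∈ S₂, k ≠ j ∧ (openGraph C).Reachable k j} := by
      rintro ⟨k, hk, j, hj, hkj, hr⟩
      exact h ⟨k, hk, j, hj, hkj, (knThm2_reachable_biUnion_iff S' (h₁ hk) j ω).1 hr⟩
    have h2 : ω ∉ {ω : BondConfig V | ∃ k ∈ S₁, ∃ j ∈ S₂, k ≠ j ∧ (openGraph ω).Reachable k j} := h
    rw [Set.indicator_of_notMem h1, Set.indicator_of_notMem h2]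

end KnThmKGeneral

section KnThmK

variable {n : ℕ}

/-- **KN Lemma 1 (i), cleared of denominators, for a single source `a` against the other relays `R' = R∖a`, with the extra decreasing
event `Q = {no two of the other relays involved are joined}`:**  `μ(D ∩ {a↔o}) · μ(D ∩ Qᶜᶜ…)`, precisely
`μ(D ∩ {a ↔ o}) · μ(D \ PC) ≤ μ(D) · μ((D \ PC) ∩ {a ↔ o})`, `D = {a ↮ R'}`, `PC = {∃ k ∈ S₁, j ∈ R', k ≠ j, k ↔ j}` (`S₁ ⊆ R'`).
[cite: KozmaNitzan2024, Lemma 1 (i) p. 5; VandenbergHaggstromKahn2006, Thm. 1.4] -/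
theorem knK_lemma1_i (w : Sym2 (Fin n) → unitInterval) (a o : Fin n) (R' S₁ : Finset (Fin n)) (haR : a ∉ R') (hS₁ : S₁ ⊆ R') :
    (prodBernoulli w).real ({ω : BondConfig (Fin n) | ∀ s ∈ ({a} : Finset (Fin n)), ∀ x ∈ R', ¬ (openGraph ω).Reachable s x} ∩
        ⋃ s ∈ ({a} : Finset (Fin n)), openConn s o) *
      (prodBernoulli w).real ({ω : BondConfig (Fin n) | ∀ s ∈ ({a} : Finset (Fin n)), ∀ x ∈ R', ¬ (openGraph ω).Reachable s x} \
        {ω | ∃ k ∈ S₁, ∃ j ∈ R', k ≠ j ∧ (openGraph ω).Reachable k j}) ≤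
    (prodBernoulli w).real {ω : BondConfig (Fin n) | ∀ s ∈ ({a} : Finset (Fin n)), ∀ x ∈ R', ¬ (openGraph ω).Reachable s x} *
      (prodBernoulli w).real (({ω : BondConfig (Fin n) | ∀ s ∈ ({a} : Finset (Fin n)), ∀ x ∈ R', ¬ (openGraph ω).Reachable s x} \
        {ω | ∃ k ∈ S₁, ∃ j ∈ R', k ≠ j ∧ (openGraph ω).Reachable k j}) ∩ ⋃ s ∈ ({a} : Finset (Fin n)), openConn s o) := by
  set D : Set (BondConfig (Fin n)) :=
    {ω : BondConfig (Fin n) | ∀ s ∈ ({a} : Finset (Fin n)), ∀ x ∈ R', ¬ (openGraph ω).Reachable s x} with hD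
  set PC : Set (BondConfig (Fin n)) := {ω | ∃ k ∈ S₁, ∃ j ∈ R', k ≠ j ∧ (openGraph ω).Reachable k j} with hPC
  set Eo : Set (BondConfig (Fin n)) := ⋃ s ∈ ({a} : Finset (Fin n)), openConn s o with hEo
  have hdisj : Disjoint ({a} : Finset (Fin n)) R' := by
    rw [Finset.disjoint_singleton_left]; exact haR
  have key := stub_bhkSets.2 n w {a} R'
    ({C : Set (Sym2 (Fin n)) | ∃ s ∈ ({a} : Finset (Fin n)), (openGraph C).Reachable s o}.indicator 1)
    ({C : Set (Sym2 (Fin n)) | ∃ k ∈ S₁, ∃ j ∈ R', k ≠ j ∧ (openGraph C).Reachable k j}.indicator 1)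
    (knThm2_monotone_anyReach {a} o) (knK_monotone_pairConn S₁ R') hdisj
  simp only [knThm2_anyReach_apply, knK_pairConn_apply R' S₁ R' hS₁] at key
  have h := knThm2_setIntegral_indicator w D Eo PC
  have h' := knThm2_setIntegral_indicator w D PC PC
  rw [← hD] at key
  rw [h.1, h'.1, h.2] at key
  -- key : μ D * μ (D ∩ (Eo ∩ PC)) ≤ μ (D ∩ Eo) * μ (D ∩ PC)
  have e1 : (prodBernoulli w).real (D ∩ Eo) = (prodBernoulli w).real (D ∩ (Eo ∩ PC)) + (prodBernoulli w).real ((D \ PC) ∩ Eo) := by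
    rw [← measureReal_union (Set.disjoint_left.2 fun ω h1 h2 => h2.1.2 h1.2.2) MeasurableSet.of_discrete]
    congr 1; ext ω; constructor
    · rintro ⟨hDω, hE⟩
      by_cases hP : ω ∈ PC
      · exact Or.inl ⟨hDω, hE, hP⟩
      · exact Or.inr ⟨⟨hDω, hP⟩, hE⟩
    · rintro (⟨hDω, hE, -⟩ | ⟨⟨hDω, -⟩, hE⟩) <;> exact ⟨hDω, hE⟩
  have e2 : (prodBernoulli w).real D = (prodBernoulli w).real (D ∩ PC) + (prodBernoulli w).real (D \ PC) := by
    rw [measureReal_inter_add_sdiff (μ := prodBernoulli w) (s := D) (MeasurableSet.of_discrete (s := PC))]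
  rw [e1, e2]
  rw [e1, e2] at key
  nlinarith [measureReal_nonneg (μ := prodBernoulli w) (s := D ∩ (Eo ∩ PC)),
    measureReal_nonneg (μ := prodBernoulli w) (s := (D \ PC) ∩ Eo),
    measureReal_nonneg (μ := prodBernoulli w) (s := D ∩ PC), measureReal_nonneg (μ := prodBernoulli w) (s := D \ PC)]

/-- **KN Lemma 1 (ii), cleared of denominators, for the source SET `T` against `R∖T`, with the extra decreasing event
`{no two relays of T are joined}`:**  `μ((D \ PC) ∩ {T↔o}) · μ(D) ≤ μ(D \ PC) · μ(D ∩ {T↔o})`, `D = {T ↮ R∖T}`,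
`PC = {∃ k ≠ j ∈ T, k ↔ j}`.  [cite: KozmaNitzan2024, Lemma 1 (ii) p. 5; VandenbergHaggstromKahn2006, Thm. 1.3] -/
theorem knK_lemma1_ii (w : Sym2 (Fin n) → unitInterval) (o : Fin n) (R T : Finset (Fin n)) :
    (prodBernoulli w).real (({ω : BondConfig (Fin n) | ∀ s ∈ T, ∀ x ∈ (↑(R \ T) : Set (Fin n)), ¬ (openGraph ω).Reachable s x} \
        {ω | ∃ k ∈ T, ∃ j ∈ T, k ≠ j ∧ (openGraph ω).Reachable k j}) ∩ ⋃ s ∈ T, openConn s o) *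
      (prodBernoulli w).real {ω : BondConfig (Fin n) | ∀ s ∈ T, ∀ x ∈ (↑(R \ T) : Set (Fin n)), ¬ (openGraph ω).Reachable s x} ≤
    (prodBernoulli w).real ({ω : BondConfig (Fin n) | ∀ s ∈ T, ∀ x ∈ (↑(R \ T) : Set (Fin n)), ¬ (openGraph ω).Reachable s x} \
        {ω | ∃ k ∈ T, ∃ j ∈ T, k ≠ j ∧ (openGraph ω).Reachable k j}) *
      (prodBernoulli w).real ({ω : BondConfig (Fin n) | ∀ s ∈ T, ∀ x ∈ (↑(R \ T) : Set (Fin n)), ¬ (openGraph ω).Reachable s x} ∩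
        ⋃ s ∈ T, openConn s o) := by
  set D : Set (BondConfig (Fin n)) :=
    {ω : BondConfig (Fin n) | ∀ s ∈ T, ∀ x ∈ (↑(R \ T) : Set (Fin n)), ¬ (openGraph ω).Reachable s x} with hD
  set PC : Set (BondConfig (Fin n)) := {ω | ∃ k ∈ T, ∃ j ∈ T, k ≠ j ∧ (openGraph ω).Reachable k j} with hPC
  set Eo : Set (BondConfig (Fin n)) := ⋃ s ∈ T, openConn s o with hEo
  have hTX : ∀ s ∈ T, s ∉ (↑(R \ T) : Set (Fin n)) := fun s hs h => by
    rw [Finset.mem_coe, Finset.mem_sdiff] at h; exact h.2 hs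
  have key := stub_bhkSets.1 n w T (↑(R \ T) : Set (Fin n))
    ({C : Set (Sym2 (Fin n)) | ∃ s ∈ T, (openGraph C).Reachable s o}.indicator 1)
    ({C : Set (Sym2 (Fin n)) | ∃ k ∈ T, ∃ j ∈ T, k ≠ j ∧ (openGraph C).Reachable k j}.indicator 1)
    (knThm2_monotone_anyReach T o) (knK_monotone_pairConn T T) hTX
  simp only [knThm2_anyReach_apply, knK_pairConn_apply T T T (subset_refl T)] at key
  have h := knThm2_setIntegral_indicator w D Eo PC
  have h' := knThm2_setIntegral_indicator w D PC PC
  rw [← hD] at key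
  rw [h.1, h'.1, h.2] at key
  -- key : μ (D ∩ Eo) * μ (D ∩ PC) ≤ μ D * μ (D ∩ (Eo ∩ PC))
  have e1 : (prodBernoulli w).real (D ∩ Eo) = (prodBernoulli w).real (D ∩ (Eo ∩ PC)) + (prodBernoulli w).real ((D \ PC) ∩ Eo) := by
    rw [← measureReal_union (Set.disjoint_left.2 fun ω h1 h2 => h2.1.2 h1.2.2) MeasurableSet.of_discrete]
    congr 1; ext ω; constructor
    · rintro ⟨hDω, hE⟩
      by_cases hP : ω ∈ PC
      · exact Or.inl ⟨hDω, hE, hP⟩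
      · exact Or.inr ⟨⟨hDω, hP⟩, hE⟩
    · rintro (⟨hDω, hE, -⟩ | ⟨⟨hDω, -⟩, hE⟩) <;> exact ⟨hDω, hE⟩
  have e2 : (prodBernoulli w).real D = (prodBernoulli w).real (D ∩ PC) + (prodBernoulli w).real (D \ PC) := by
    rw [measureReal_inter_add_sdiff (μ := prodBernoulli w) (s := D) (MeasurableSet.of_discrete (s := PC))]
  rw [e1, e2]
  rw [e1, e2] at key
  nlinarith [measureReal_nonneg (μ := prodBernoulli w) (s := D ∩ (Eo ∩ PC)),
    measureReal_nonneg (μ := prodBernoulli w) (s := (D \ PC) ∩ Eo),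
    measureReal_nonneg (μ := prodBernoulli w) (s := D ∩ PC), measureReal_nonneg (μ := prodBernoulli w) (s := D \ PC)]

/-- The event `M_T = {every relay of T is separated from every other relay of R}` as seen from one source `i ∈ T`. [folklore] -/
theorem knK_M_eq_single (R T : Finset (Fin n)) (hTR : T ⊆ R) {i : Fin n} (hi : i ∈ T) :
    ({ω : BondConfig (Fin n) | ∀ s ∈ ({i} : Finset (Fin n)), ∀ x ∈ R.erase i, ¬ (openGraph ω).Reachable s x} \
        {ω | ∃ k ∈ T.erase i, ∃ j ∈ R.erase i, k ≠ j ∧ (openGraph ω).Reachable k j}) =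
      {ω : BondConfig (Fin n) | ∀ k ∈ T, ∀ j ∈ R, k ≠ j → ¬ (openGraph ω).Reachable k j} := by
  ext ω
  simp only [Set.mem_sdiff, Set.mem_setOf_eq, Finset.mem_singleton, forall_eq, Finset.mem_erase, ne_eq, not_exists, not_and]
  constructor
  · rintro ⟨h1, h2⟩ k hk j hj hkj
    by_cases hki : k = i
    · subst hki
      exact h1 j ⟨fun h => hkj h.symm, hj⟩
    · by_cases hji : j = i
      · subst hji
        intro hr
        exact h1 k ⟨hki, hTR hk⟩ hr.symm
      · exact h2 k ⟨hki, hk⟩ j ⟨hji, hj⟩ hkj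
  · intro h
    refine ⟨fun j hj => h i hi j hj.2 (fun e => hj.1 e.symm), fun k hk j hj hkj => h k hk.2 j hj.2 hkj⟩

/-- The event `M_T` as seen from the source set `T`. [folklore] -/
theorem knK_M_eq_set (R T : Finset (Fin n)) (hTR : T ⊆ R) :
    ({ω : BondConfig (Fin n) | ∀ s ∈ T, ∀ x ∈ (↑(R \ T) : Set (Fin n)), ¬ (openGraph ω).Reachable s x} \
        {ω | ∃ k ∈ T, ∃ j ∈ T, k ≠ j ∧ (openGraph ω).Reachable k j}) =
      {ω : BondConfig (Fin n) | ∀ k ∈ T, ∀ j ∈ R, k ≠ j → ¬ (openGraph ω).Reachable k j} := by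
  ext ω
  simp only [Set.mem_sdiff, Set.mem_setOf_eq, Finset.coe_sdiff, Set.mem_sdiff, Finset.mem_coe, ne_eq, not_exists, not_and]
  constructor
  · rintro ⟨h1, h2⟩ k hk j hj hkj
    by_cases hjT : j ∈ T
    · exact h2 k hk j hjT hkj
    · exact h1 k hk j ⟨hj, hjT⟩
  · intro h
    exact ⟨fun s hs x hx => h s hs x hx.1 (fun e => hx.2 (e ▸ hs)), fun k hk j hj hkj => h k hk j (hTR hj) hkj⟩

/-- **Kozma–Nitzan's Lemma 2 (general form, singleton decomposition):** if all relays of `T ⊆ R` are simultaneously separable from the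
other relays with positive probability, then `Σ_{i ∈ T} φ_{i} ≤ φ_T`, where `φ_T = μ({T ↮ R∖T} ∩ {T ↔ o}) / μ(T ↮ R∖T)`.
[cite: KozmaNitzan2024, Lemma 2 p. 6] -/
theorem knK_lemma2 (w : Sym2 (Fin n) → unitInterval) (o : Fin n) (R T : Finset (Fin n)) (hTR : T ⊆ R)
    (hM : 0 < (prodBernoulli w).real {ω : BondConfig (Fin n) | ∀ k ∈ T, ∀ j ∈ R, k ≠ j → ¬ (openGraph ω).Reachable k j}) :
    ∑ i ∈ T, (prodBernoulli w).real ({ω : BondConfig (Fin n) | ∀ x ∈ R.erase i, ¬ (openGraph ω).Reachable i x} ∩ openConn i o) /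
        (prodBernoulli w).real {ω : BondConfig (Fin n) | ∀ x ∈ R.erase i, ¬ (openGraph ω).Reachable i x} ≤
      (prodBernoulli w).real ({ω : BondConfig (Fin n) | ∀ s ∈ T, ∀ x ∈ (↑(R \ T) : Set (Fin n)), ¬ (openGraph ω).Reachable s x} ∩
          ⋃ s ∈ T, openConn s o) /
        (prodBernoulli w).real {ω : BondConfig (Fin n) | ∀ s ∈ T, ∀ x ∈ (↑(R \ T) : Set (Fin n)), ¬ (openGraph ω).Reachable s x} := by
  set M : Set (BondConfig (Fin n)) := {ω : BondConfig (Fin n) | ∀ k ∈ T, ∀ j ∈ R, k ≠ j → ¬ (openGraph ω).Reachable k j} with hMdef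
  set D : Set (BondConfig (Fin n)) :=
    {ω : BondConfig (Fin n) | ∀ s ∈ T, ∀ x ∈ (↑(R \ T) : Set (Fin n)), ¬ (openGraph ω).Reachable s x} with hD
  -- (1) for each `i ∈ T`: `φ_i · μ(M) ≤ μ(M ∩ {i ↔ o})`
  have h1 : ∀ i ∈ T, (prodBernoulli w).real ({ω : BondConfig (Fin n) | ∀ x ∈ R.erase i, ¬ (openGraph ω).Reachable i x} ∩ openConn i o) /
        (prodBernoulli w).real {ω : BondConfig (Fin n) | ∀ x ∈ R.erase i, ¬ (openGraph ω).Reachable i x} * (prodBernoulli w).real M ≤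
      (prodBernoulli w).real (M ∩ openConn i o) := by
    intro i hi
    have L := knK_lemma1_i w i o (R.erase i) (T.erase i) (Finset.notMem_erase i R) (Finset.erase_subset_erase i hTR)
    rw [knK_M_eq_single R T hTR hi, Finset.set_biUnion_singleton] at L
    have hDi : {ω : BondConfig (Fin n) | ∀ s ∈ ({i} : Finset (Fin n)), ∀ x ∈ R.erase i, ¬ (openGraph ω).Reachable s x} =
        {ω : BondConfig (Fin n) | ∀ x ∈ R.erase i, ¬ (openGraph ω).Reachable i x} := by
      ext ω; simp only [Set.mem_setOf_eq, Finset.mem_singleton, forall_eq]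
    rw [hDi, ← hMdef] at L
    -- L : μ (Dᵢ ∩ {i↔o}) * μ M ≤ μ Dᵢ * μ (M ∩ {i↔o})
    set Di : Set (BondConfig (Fin n)) := {ω : BondConfig (Fin n) | ∀ x ∈ R.erase i, ¬ (openGraph ω).Reachable i x} with hDidef
    by_cases hDi0 : (prodBernoulli w).real Di = 0
    · rw [hDi0, div_zero, zero_mul]; exact measureReal_nonneg
    · have hDipos : 0 < (prodBernoulli w).real Di := lt_of_le_of_ne measureReal_nonneg (Ne.symm hDi0)
      rw [div_mul_eq_mul_div, div_le_iff₀ hDipos]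
      linarith
  -- (2) the events `M ∩ {i ↔ o}`, `i ∈ T`, are pairwise disjoint and lie in `M ∩ {T ↔ o}`
  have h2 : ∑ i ∈ T, (prodBernoulli w).real (M ∩ openConn i o) ≤ (prodBernoulli w).real (M ∩ ⋃ s ∈ T, openConn s o) := by
    rw [← measureReal_biUnion_finset (μ := prodBernoulli w)
      (fun i hi j hj hij => Set.disjoint_left.2 fun ω hωi hωj =>
        hωi.1 i hi j (hTR hj) hij (blockGrowth_openConn_trans hωi.2 (blockGrowth_openConn_symm hωj.2)))
      (fun i _ => MeasurableSet.of_discrete)]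
    refine measureReal_mono (fun ω hω => ?_) (measure_ne_top _ _)
    simp only [Set.mem_iUnion, Set.mem_inter_iff, exists_prop] at hω ⊢
    obtain ⟨i, hi, hMω, hio⟩ := hω
    exact ⟨hMω, i, hi, hio⟩
  -- (3) `μ(M ∩ {T ↔ o}) ≤ φ_T · μ(M)`
  have h3 := knK_lemma1_ii w o R T
  rw [knK_M_eq_set R T hTR, ← hMdef, ← hD] at h3
  -- h3 : μ (M ∩ {T↔o}) * μ D ≤ μ M * μ (D ∩ {T↔o})
  have hMD : M ⊆ D := fun ω hω s hs x hx => by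
    rw [Finset.coe_sdiff, Set.mem_sdiff, Finset.mem_coe, Finset.mem_coe] at hx
    exact hω s hs x hx.1 (fun e => hx.2 (e ▸ hs))
  have hDpos : 0 < (prodBernoulli w).real D := lt_of_lt_of_le hM (measureReal_mono hMD (measure_ne_top _ _))
  have hsum := Finset.sum_le_sum h1  -- Σ φ_i μ M ≤ Σ μ(M ∩ {i↔o})
  rw [← Finset.sum_mul] at hsum
  have h4 : (∑ i ∈ T, (prodBernoulli w).real ({ω : BondConfig (Fin n) | ∀ x ∈ R.erase i, ¬ (openGraph ω).Reachable i x} ∩ openConn i o) /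
        (prodBernoulli w).real {ω : BondConfig (Fin n) | ∀ x ∈ R.erase i, ¬ (openGraph ω).Reachable i x}) * (prodBernoulli w).real M
      ≤ (prodBernoulli w).real (D ∩ ⋃ s ∈ T, openConn s o) / (prodBernoulli w).real D * (prodBernoulli w).real M := by
    refine le_trans hsum (le_trans h2 ?_)
    rw [div_mul_eq_mul_div, le_div_iff₀ hDpos]
    linarith
  exact le_of_mul_le_mul_right h4 hM

end KnThmK

end

end Summit.CriticalPhenomena.PercolationContinuityZ3.Theorems
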